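import Summits.FinalStateConjecture.FinalStateConjecture.Theorems.SeamedChartsExhaust.Negative.ExactSchwarzschildClauses

/-!
# `NeckGapDecay` (crux stmt-FinalStateConjecture-16768, route StarvedNecks) — negative side, model facts (1/2):
# the exact Schwarzschild `N = 1` decomposition with late time `τ₀ = 1`; escape from the tube wall

Refuter seat `refuter-cdisprove-stmt-FinalStateConjecture-16768-0` (crux disprover, 2026-08-17).  Part 1 of
the small-model facts for `Theses.StarvedNecks.NeckGapDecay` (part 2: `ExactSchwarzschildGapCertificate`).

* `SchwGap.decompK P k` — the exact Schwarzschild `N = 1` decomposition of the model of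
  `SeamedChartsExhaust.Negative.SchwModel` (identity hole chart on the boosted exterior of the trivial
  motion, identity flat chart on `U = {x⁰ > −1, r > R₀ + 1 + √x⁰}`, excision `ρ = R₀ + 1 + √·`), in
  EVERY regularity class `Cᵏ` and with late time `τ₀ = 1` — not `0`: below flat time `1` the tube wall
  `R₀ + 1 + √t` expands faster than light, and clause (1) of the crux's `HonestFar` (flat-late points lie
  below later flat slabs) FAILS for `SchwModel.decomp` there (a flat point hugging the wall at time `δ²`
  cannot reach the flat slab at time `4δ²`, which starts `δ` further out); from `t ≥ 1` the wall speed
  is `≤ 1/2` (`ρ_add_le`).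
* `SchwGap.flat_mem_causalPast_slab` — ESCAPE: a flat point `y` with `y⁰ ≥ 1` reaches every later flat
  slab inside `U` along the tilted coordinate line `y + σ (∂₀ + (3/4) ȳ/‖ȳ‖)`, which is future
  timelike wherever `r ≥ 14 M` by the coordinate bound `g(v,v) ≤ η(v,v) + 2(M/r)(|v⁰| + ‖v̄‖)²`
  (`schw_bilin_self_le`, Cauchy–Schwarz on `ℓ = (1, x̄/r)`), and `g(V, v) = −v⁰ = −1`.

References: Dafermos–Rodnianski arXiv:0811.0354 §5.1 (ingoing Kerr–Schild coordinates, `∇t*`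
timelike); Kerr–Schild 1965 §3; O'Neill 1983 Ch. 14 pp. 402–403; DHRT arXiv:2104.08222 §1.
-/

noncomputable section

open TopologicalSpace Manifold Filter Topology Set Function
open scoped ContDiff Topology ENNReal Manifold

-- instance search through nested operator types `E4 →L E4 →L E4 →L ℝ` (as in the tree files)
set_option maxSynthPendingDepth 3

namespace Summit.FinalStateConjecture.FinalStateConjecture.Theorems.NeckGapDecay.Negative

open Literature.Geometry.Lorentzian LorentzianMetric
open Summit.FinalStateConjecture.FinalStateConjecture.Theorems.SeamedChartsExhaust.Negative
open Summit.FinalStateConjecture.FinalStateConjecture.Theorems.SeamedChartsExhaust.Negative.SchwModel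

set_option linter.dupNamespace false
namespace SchwGap

variable (P : Params)

/-! ### The model in class `Cᵏ` with late time `τ₀ = 1` -/

/-- Late-time chart property (after chart time `τ₀`) of an inclusion of open subsets of `E4` into the
patch: smooth, an open embedding of the (open) late region, hole-late points in `O`. [folklore] -/
theorem isLateChart_inclusion_at (B : ModelBackground) (hV : B.domain ≤ Kerr.region 0 P.r₀)
    (htime : Continuous B.time) (τ₀ : ℝ)
    (hO : ∀ x : B.domain, τ₀ < B.time x.1 → 2 * P.M < Kerr.radius 0 x.1) :
    (ST P).IsLateChart B (O P) τ₀ (Opens.inclusion hV : B.domain → (ST P).carrier) := by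
  refine ⟨contMDiff_inclusion (n := ∞) hV, ?_, ?_⟩
  · have hlate : IsOpen (B.lateRegion τ₀) :=
      isOpen_lt continuous_const (htime.comp continuous_subtype_val)
    have hg : IsOpenEmbedding (fun x : B.lateRegion τ₀ ↦ (x.1.1 : E4)) :=
      B.domain.2.isOpenEmbedding_subtypeVal.comp hlate.isOpenEmbedding_subtypeVal
    have hcar : IsOpenEmbedding (Subtype.val : (ST P).carrier → E4) :=
      (Kerr.region 0 P.r₀).2.isOpenEmbedding_subtypeVal
    exact IsOpenEmbedding.of_comp _ hcar hg
  · rintro _ ⟨x, hx, rfl⟩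
    exact hO x hx

/-- The identity Kerr chart is a late-time chart into `O` after any chart time. [folklore] -/
theorem isLateChart_ΨK_at (τ₀ : ℝ) : (ST P).IsLateChart (Kerr.background P.M 0) (O P) τ₀ (ΨK P) :=
  isLateChart_inclusion_at P _ (hext P) (PiLp.continuous_apply 2 _ 0) τ₀ fun x _ ↦
    (mem_exterior_iff P).mp x.2

/-- The identity hole chart is a late-time chart into `O` after any chart time. [folklore] -/
theorem isLateChart_Ψ_at (τ₀ : ℝ) :
    (ST P).IsLateChart (boostedKerrBackground 1 0 P.M 0) (O P) τ₀ (Ψ P) :=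
  isLateChart_inclusion_at P _ (hbext P)
    ((PiLp.continuous_apply 2 _ 0).comp (continuous_poincareInv 1 0)) τ₀ fun x _ ↦
    (mem_bext_iff P).mp x.2

/-- The identity flat chart is a late-time chart into `O` after any chart time. [folklore] -/
theorem isLateChart_Φ_at (τ₀ : ℝ) :
    (ST P).IsLateChart (Minkowski.backgroundOn (U P)) (O P) τ₀ (Φ P) :=
  (ST P).isLateChart_backgroundOn_comp_inclusion (isLateChart_ΨK_at P τ₀) (hUext P)

/-- The `N = 1` exact Schwarzschild decomposition of `O = {r > 2M}` in class `Cᵏ`, late time `τ₀ = 1`: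
motion `(1, 0)`, identity hole chart, flat chart the identity on `U = {x⁰ > −1, r > R₀ + 1 + √x⁰}`,
excision `ρ = R₀ + 1 + √·`.  (All convergence clauses hold with IDENTICALLY vanishing hole deviation
and the Kerr–Schild tail for the flat chart, in every `Cᵏ`.) -/
def decompK (k : ℕ) : FinalStateDecomposition (ST P) (O P) k where
  N := 1
  mass _ := P.M
  spin _ := 0
  mass_pos _ := P.hM
  abs_spin_le_mass _ := by rw [abs_zero]; exact P.hM.le
  motion _ := (1, 0)
  τ₀ := 1
  chart _ := Ψ P
  isLateChart _ := isLateChart_Ψ_at P 1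
  tendsto_truncDeviationCk _ R := by
    simp_rw [truncDeviationCk_Ψ]
    exact tendsto_const_nhds
  exists_pairwise_disjoint _ := ⟨0, Subsingleton.pairwise⟩
  excision _ := ρ P
  tendsto_excision_div _ := ρ_div_tendsto P
  flatDomain := U P
  setOf_lt_excision_subset_flatDomain := by
    rintro x ⟨hx0, hx⟩
    have h := hx 0
    rw [poincareInv_one_zero] at h
    exact ⟨by linarith, h⟩
  flatChart := Φ P
  isLateChart_flat := isLateChart_Φ_at P 1
  tendsto_deviationCk_flat := by
    refine (ST P).tendsto_deviationCk_backgroundOn (isLateChart_ΨK P).contMDiff ?_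
      (ρ_tendsto_atTop P) (fun z (hz : z ∈ U P) ↦ hz.2) (hUext P)
    simp_rw [deviationCk_ΨK]
    exact tendsto_const_nhds
  diff_subset_causalPast := by
    rintro p ⟨hpO, hpn⟩
    -- `p⁰ ≤ 1`, otherwise `p` is hole-late charted
    have hp0 : p.1 0 ≤ 1 := by
      by_contra h
      push Not at h
      apply hpn
      refine Or.inl (mem_iUnion.mpr ⟨0, ?_⟩)
      obtain ⟨hp', hpeq⟩ := eq_Ψ P p hpO
      refine ⟨⟨p.1, hp'⟩, ?_, hpeq⟩
      show 1 < poincareInv 1 0 p.1 0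
      rwa [poincareInv_one_zero]
    -- flow up to time `1`, landing on the initial hole slab
    set s : ℝ := 1 - p.1 0 with hs
    have hs0 : 0 ≤ s := by linarith
    refine causalFuture_mono (singleton_subset_iff.mpr ?_) (mem_causalPast_up P p hpO hs0)
    refine Or.inl (mem_iUnion.mpr ⟨(0 : Fin 1), ?_⟩)
    have hqO : up P p s ∈ O P := by rw [mem_O, radius_up]; exact hpO
    obtain ⟨hq', hqeq⟩ := eq_Ψ P (up P p s) hqO
    refine ⟨⟨(up P p s).1, hq'⟩, ?_, hqeq⟩
    show poincareInv 1 0 (up P p s).1 0 = 1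
    rw [poincareInv_one_zero, up_zero_apply, hs]
    ring

variable (k : ℕ)

/-- The model has one hole. [folklore] -/
theorem decompK_N : (decompK P k).N = 1 := rfl
/-- The model has `τ₀ = 1`. [folklore] -/
theorem decompK_τ₀ : (decompK P k).τ₀ = 1 := rfl
/-- The hole chart of the model. [folklore] -/
theorem decompK_chart (i : Fin (decompK P k).N) : (decompK P k).chart i = Ψ P := rfl
/-- The hole background of the model. [folklore] -/
theorem decompK_background (i : Fin (decompK P k).N) :
    (decompK P k).background i = boostedKerrBackground 1 0 P.M 0 := rfl
/-- The flat domain of the model. [folklore] -/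
theorem decompK_flatDomain : (decompK P k).flatDomain = U P := rfl
/-- The flat chart of the model. [folklore] -/
theorem decompK_flatChart : (decompK P k).flatChart = Φ P := rfl
/-- The excision profile of the model. [folklore] -/
theorem decompK_excision (i : Fin (decompK P k).N) : (decompK P k).excision i = ρ P := rfl
/-- The motion of the model is trivial. [folklore] -/
theorem decompK_motion (i : Fin (decompK P k).N) : (decompK P k).motion i = (1, 0) := rfl

/-- The hole index type `Fin 1` of the model is a subsingleton. [folklore] -/
theorem subsingleton_fin_N : Subsingleton (Fin (decompK P k).N) :=
  show Subsingleton (Fin 1) from inferInstance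


/-! ### Escape from the tube wall: tilted coordinate lines are future timelike -/

/-- For `a = 0` and `r > 0`: `ℓ(v) = v⁰ + ⟨x̄, v̄⟩ / r`. -/
theorem nullCovector_zero_apply {x : E4} (hx : 0 < Kerr.radius 0 x) (v : E4) :
    Kerr.nullCovector 0 x v = v 0 + (x 1 * v 1 + x 2 * v 2 + x 3 * v 3) / Kerr.radius 0 x := by
  have hr0 : Kerr.radius 0 x ≠ 0 := hx.ne'
  simp only [Kerr.nullCovector, Kerr.nullCovectorFun, E4.covector_apply, Fin.sum_univ_four,
    Fin.isValue, Matrix.cons_val_zero, Matrix.cons_val_one, Matrix.cons_val, zero_mul,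
    add_zero, sub_zero, ne_eq, OfNat.ofNat_ne_zero, not_false_eq_true, zero_pow]
  field_simp
  ring

/-- Cauchy–Schwarz bound on the Kerr–Schild null covector for `a = 0`: `|ℓ(v)| ≤ |v⁰| + ‖v̄‖`. -/
theorem abs_nullCovector_zero_le {x : E4} (hx : 0 < Kerr.radius 0 x) (v : E4) :
    |Kerr.nullCovector 0 x v| ≤ |v 0| + E4.spatialNorm v := by
  set r := Kerr.radius 0 x with hr
  set n := E4.spatialNorm v with hn
  set S := x 1 * v 1 + x 2 * v 2 + x 3 * v 3 with hS
  have hrsq : r ^ 2 = x 1 ^ 2 + x 2 ^ 2 + x 3 ^ 2 := by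
    rw [hr, Kerr.radius_zero_left, E4.spatialNorm_sq]
  have hnsq : n ^ 2 = v 1 ^ 2 + v 2 ^ 2 + v 3 ^ 2 := E4.spatialNorm_sq v
  have hn0 : 0 ≤ n := E4.spatialNorm_nonneg v
  have hCS : S ^ 2 ≤ (r * n) ^ 2 := by
    rw [mul_pow, hrsq, hnsq, hS]
    nlinarith [sq_nonneg (x 1 * v 2 - x 2 * v 1), sq_nonneg (x 1 * v 3 - x 3 * v 1),
      sq_nonneg (x 2 * v 3 - x 3 * v 2)]
  have hSle : |S| ≤ r * n := by
    have h0 : 0 ≤ r * n := mul_nonneg hx.le hn0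
    rw [← Real.sqrt_sq_eq_abs, ← Real.sqrt_sq h0]
    exact Real.sqrt_le_sqrt hCS
  rw [nullCovector_zero_apply hx, ← hS]
  calc |v 0 + S / r| ≤ |v 0| + |S / r| := abs_add_le _ _
    _ = |v 0| + |S| / r := by rw [abs_div, abs_of_pos hx]
    _ ≤ |v 0| + n := by
        gcongr
        rw [div_le_iff₀ hx]
        linarith [mul_comm r n]

/-- Schwarzschild Kerr–Schild form: `g(v, v) ≤ η(v, v) + 2(M/r)(|v⁰| + ‖v̄‖)²` for `M ≥ 0`, `r > 0`. -/
theorem schw_bilin_self_le {M : ℝ} (hM : 0 ≤ M) {x : E4} (hx : 0 < Kerr.radius 0 x) (v : E4) :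
    Kerr.bilin M 0 x v v ≤
      Minkowski.bilin v v + 2 * (M / Kerr.radius 0 x) * (|v 0| + E4.spatialNorm v) ^ 2 := by
  rw [Kerr.bilin_apply, Schw.scalarH_zero M hx]
  have hH : 0 ≤ 2 * (M / Kerr.radius 0 x) := by positivity
  have h := abs_nullCovector_zero_le hx v
  have hsq : Kerr.nullCovector 0 x v * Kerr.nullCovector 0 x v ≤ (|v 0| + E4.spatialNorm v) ^ 2 := by
    rw [← sq, ← sq_abs]
    exact pow_le_pow_left₀ (abs_nonneg _) h 2
  have := mul_le_mul_of_nonneg_left hsq hH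
  linarith

/-- `η(v, v) = −(v⁰)² + ‖v̄‖²` (local copy of a landed computation, kept private). -/
private theorem minkowski_self (v : E4) : Minkowski.bilin v v = -(v 0) ^ 2 + E4.spatialNorm v ^ 2 := by
  rw [Minkowski.bilin_apply, E4.spatialNorm_sq, Fin.sum_univ_three]
  simp only [Fin.isValue, Fin.succ_zero_eq_one, Fin.succ_one_eq_two]
  have : (Fin.succ (2 : Fin 3) : Fin 4) = 3 := rfl
  rw [this]
  ring

/-- The spatial part of `∂₀` vanishes (local copy of a landed computation, kept private). -/
private theorem spatial_basisVector_zero : E4.spatial (E4.basisVector 0) = 0 := by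
  ext i
  simp [E4.spatial_apply, Fin.succ_ne_zero]

/-- The radial ESCAPE VECTOR at `y`: `v = ∂₀ + (3 / (4‖ȳ‖)) (0, ȳ)` (outward speed `3/4`). -/
def escVec (y : E4) : E4 :=
  E4.basisVector 0 + (3 / (4 * E4.spatialNorm y)) • E4.ofTimeSpace 0 (E4.spatial y)

/-- The escape vector has unit time component. [folklore] -/
theorem escVec_apply_zero (y : E4) : escVec y 0 = 1 := by
  simp [escVec]

/-- The spatial part of the escape vector is `(3/(4‖ȳ‖)) ȳ`. [folklore] -/
theorem spatial_escVec (y : E4) :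
    E4.spatial (escVec y) = (3 / (4 * E4.spatialNorm y)) • E4.spatial y := by
  simp only [escVec, map_add, map_smul, spatial_basisVector_zero, E4.spatial_ofTimeSpace, zero_add]

/-- The escape vector has spatial speed `3/4`. [folklore] -/
theorem spatialNorm_escVec {y : E4} (hy : 0 < E4.spatialNorm y) : E4.spatialNorm (escVec y) = 3 / 4 := by
  rw [E4.spatialNorm, spatial_escVec, norm_smul, Real.norm_eq_abs, abs_of_nonneg (by positivity)]
  rw [show ‖E4.spatial y‖ = E4.spatialNorm y from rfl]
  field_simp

/-- Time along the escape line: `(y + σ v)⁰ = y⁰ + σ`. [folklore] -/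
theorem add_smul_escVec_apply_zero (y : E4) (σ : ℝ) : (y + σ • escVec y) 0 = y 0 + σ := by
  simp [escVec_apply_zero]

/-- The escape line is radial: `spatial (y + σ v) = (1 + 3σ/(4‖ȳ‖)) ȳ`. [folklore] -/
theorem spatial_add_smul_escVec (y : E4) (σ : ℝ) :
    E4.spatial (y + σ • escVec y) = (1 + σ * (3 / (4 * E4.spatialNorm y))) • E4.spatial y := by
  rw [map_add, map_smul, spatial_escVec, smul_smul, add_smul, one_smul]

/-- Radius along the escape line: `r(y + σ v) = ‖ȳ‖ + 3σ/4` (while `1 + 3σ/(4‖ȳ‖) ≥ 0`). [folklore] -/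
theorem radius_add_smul_escVec {y : E4} (hy : 0 < E4.spatialNorm y) {σ : ℝ}
    (hσ : 0 ≤ 1 + σ * (3 / (4 * E4.spatialNorm y))) :
    Kerr.radius 0 (y + σ • escVec y) = E4.spatialNorm y + 3 / 4 * σ := by
  rw [Kerr.radius_zero_left, E4.spatialNorm, spatial_add_smul_escVec, norm_smul, Real.norm_eq_abs,
    abs_of_nonneg hσ, show ‖E4.spatial y‖ = E4.spatialNorm y from rfl]
  field_simp

/-- `η(v, v) = −1 + 9/16 = −7/16` for the escape vector. [folklore] -/
theorem minkowski_escVec {y : E4} (hy : 0 < E4.spatialNorm y) :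
    Minkowski.bilin (escVec y) (escVec y) = -7 / 16 := by
  rw [minkowski_self, escVec_apply_zero, spatialNorm_escVec hy]
  norm_num

/-- The escape vector is non-zero. [folklore] -/
theorem escVec_ne_zero (y : E4) : escVec y ≠ 0 := by
  intro h
  have := congrArg (fun z : E4 ↦ z 0) h
  rw [escVec_apply_zero] at this
  simp at this

/-- Along the escape direction the Kerr–Schild form is future timelike wherever `r ≥ 14 M`. -/
theorem isFutureDirected_escVec {y : E4} (hy : 0 < E4.spatialNorm y) (z : (ST P).carrier)
    (hz : 14 * P.M ≤ Kerr.radius 0 z.1) :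
    (ST P).timeOrientation.IsFutureDirected (x := z) (escVec y) := by
  have hr : 0 < Kerr.radius 0 z.1 := by linarith [P.hM]
  refine ⟨⟨?_, escVec_ne_zero y⟩, ?_⟩
  · change Kerr.bilin P.M 0 z.1 (escVec y) (escVec y) ≤ 0
    have h := schw_bilin_self_le P.hM.le hr (escVec y)
    rw [minkowski_escVec hy, escVec_apply_zero, spatialNorm_escVec hy] at h
    have hMr : P.M / Kerr.radius 0 z.1 ≤ 1 / 14 := by
      rw [div_le_div_iff₀ hr (by norm_num)]; linarith
    have : |(1 : ℝ)| + 3 / 4 = 7 / 4 := by norm_num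
    rw [this] at h
    nlinarith
  · change Kerr.bilin P.M 0 z.1 (Kerr.timeVector P.M 0 z.1) (escVec y) < 0
    rw [Kerr.bilin_timeVector hr, escVec_apply_zero]
    norm_num

/-- `√(t + σ) ≤ √t + σ/2` for `t ≥ 1`, `σ ≥ 0` (the tube wall `R₀ + 1 + √·` has slope `≤ 1/2` from `1`). -/
theorem sqrt_add_le {t σ : ℝ} (ht : 1 ≤ t) (hσ : 0 ≤ σ) : √(t + σ) ≤ √t + σ / 2 := by
  have ht0 : 0 ≤ t := by linarith
  have h1 : 1 ≤ √t := by rw [show (1:ℝ) = √1 from Real.sqrt_one.symm]; exact Real.sqrt_le_sqrt ht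
  rw [Real.sqrt_le_iff]
  constructor
  · positivity
  · nlinarith [Real.sq_sqrt ht0, Real.sqrt_nonneg t]



/-- `ρ` is monotone. -/
theorem ρ_mono {a b : ℝ} (h : a ≤ b) : ρ P a ≤ ρ P b := by
  unfold ρ; linarith [Real.sqrt_le_sqrt h]

/-- From flat time `1` the tube wall expands at speed `≤ 1/2`: `ρ(t + σ) ≤ ρ(t) + σ/2`. -/
theorem ρ_add_le {t σ : ℝ} (ht : 1 ≤ t) (hσ : 0 ≤ σ) : ρ P (t + σ) ≤ ρ P t + σ / 2 := by
  unfold ρ; linarith [sqrt_add_le ht hσ]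

/-- **Escape from the tube wall** (the content of `HonestFar` (1) on the model): a flat point `y`
(`y ∈ U`, `y⁰ ≥ 1`) reaches the flat slab at any later time `τ₂` along the escape direction,
staying in `U`: `Φ y ≤ Φ (y + (τ₂ − y⁰) v)`. -/
theorem flat_mem_causalPast_slab (y : (Minkowski.backgroundOn (U P)).domain) (hy1 : 1 ≤ y.1 0)
    {τ₂ : ℝ} (hτ₂ : y.1 0 < τ₂) :
    ∃ hmem : y.1 + (τ₂ - y.1 0) • escVec y.1 ∈ U P,
      Φ P y ∈ (ST P).metric.causalPast (ST P).timeOrientation {Φ P ⟨y.1 + (τ₂ - y.1 0) • escVec y.1, hmem⟩} := by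
  obtain ⟨hyt, hyr⟩ := y.2
  set n : ℝ := E4.spatialNorm y.1 with hn
  have hrn : Kerr.radius 0 y.1 = n := Kerr.radius_zero_left _
  rw [hrn] at hyr
  have hρ1 : P.R₀ + 1 ≤ ρ P (y.1 0) := ρ_ge P _
  have hn1 : 1 < n := by linarith [P.R₀_pos]
  have hn0 : 0 < n := by linarith
  set s : ℝ := τ₂ - y.1 0 with hs
  have hs0 : 0 < s := by linarith
  set ε : ℝ := min (1 / 2) (n - ρ P (y.1 0)) with hε
  have hε0 : 0 < ε := lt_min (by norm_num) (by linarith)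
  have hε1 : ε ≤ 1 / 2 := min_le_left _ _
  have hε2 : ε ≤ n - ρ P (y.1 0) := min_le_right _ _
  -- the segment (with margins) stays in `U`
  have hcoef : ∀ σ, -ε ≤ σ → 0 ≤ 1 + σ * (3 / (4 * E4.spatialNorm y.1)) := by
    intro σ hσ
    rw [← hn]
    have : -1 ≤ σ * (3 / (4 * n)) := by
      rw [mul_div_assoc', le_div_iff₀ (by positivity)]
      nlinarith
    linarith
  have hrad : ∀ σ, -ε ≤ σ → Kerr.radius 0 (y.1 + σ • escVec y.1) = n + 3 / 4 * σ := fun σ hσ ↦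
    radius_add_smul_escVec hn0 (hcoef σ hσ)
  have hmem : ∀ σ ∈ Icc (-ε) (s + ε), y.1 + σ • escVec y.1 ∈ U P := by
    intro σ hσ
    refine ⟨?_, ?_⟩
    · rw [add_smul_escVec_apply_zero]; linarith [hσ.1]
    · rw [add_smul_escVec_apply_zero, hrad σ hσ.1]
      rcases le_or_gt σ 0 with hσ0 | hσ0
      · have h1 : ρ P (y.1 0 + σ) ≤ ρ P (y.1 0) := ρ_mono P (by linarith)
        linarith [hσ.1]
      · have h1 := ρ_add_le P hy1 hσ0.le
        linarith
  have hfut : ∀ z : (Minkowski.backgroundOn (U P)).domain,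
      z.1 ∈ (fun σ : ℝ ↦ y.1 + σ • escVec y.1) '' Icc 0 s →
      (ST P).timeOrientation.IsFutureDirected (mfderiv 𝓘(ℝ, E4) (𝓡 4) (Φ P) z (escVec y.1)) := by
    rintro z ⟨σ, hσ, hz⟩
    have hzr : 14 * P.M ≤ Kerr.radius 0 (Φ P z).1 := by
      rw [Φ_val, ← hz, hrad σ (by linarith [hσ.1])]
      linarith [hσ.1, P.hR₀, P.hM]
    exact (congrArg (fun w : E4 ↦ (ST P).timeOrientation.IsFutureDirected (x := Φ P z) w)
      (OpensChart.mfderiv_inclusion_apply (hUreg P) z (escVec y.1))).mpr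
        (isFutureDirected_escVec P hn0 (Φ P z) hzr)
  have key := line_mem_causalFuture (𝓢 := ST P) (U := U P) (Φ := Φ P) (isLateChart_Φ P).contMDiff
    (escVec y.1) y.1 y.2 hs0.le hε0 hmem hfut
  exact ⟨hmem s ⟨by linarith, by linarith⟩, mem_causalPast_of_mem_causalFuture key⟩


end SchwGap

end Summit.FinalStateConjecture.FinalStateConjecture.Theorems.NeckGapDecay.Negative

end
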